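import Literature.MathematicalPhysics.QuantumFieldTheory.AdmissiblePlaquetteWeight
import HarnessLib

/-!
# Lüscher's admissibility-constrained plaquette weight: measurability, continuity, `0 < Z`,
and the comparison with the norm form

Companion proofs file of `AdmissiblePlaquetteWeight` (same namespace; theorems only). For a
compact group `G` with a continuous matrix representation `ρ : G →* M_N(ℂ)`, the torus
`(ℤ/Lℤ)^d`, inverse coupling `β` and cut `δ`:

* the cut-off factor `admissibleCutoff β δ` is measurable, continuous below the cut, and for
  `β > 0 < δ` continuous on all of `ℝ` (`continuous_admissibleCutoff`: `β t/(1 - t/δ) → +∞` as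
  `t ↑ δ`; Lüscher 1999 §2.1 remarks that the Boltzmann factor is even smooth); as `δ → ∞` it
  tends to the Wilson factor `exp(-β t)`, and the weight to `exp(-β · wilsonAction)`
  (`tendsto_admissibleCutoff_atTop`, `tendsto_admissiblePlaquetteWeight_atTop`);
* the plaquette defect, the admissible set and the weight `admissiblePlaquetteWeight ρ β δ` are
  measurable for the PRODUCT σ-algebra on `Edge → G` without any countability assumption on `G`
  (entrywise, as in `ConstructiveQFTWave0Proofs`), the admissible set is open with positive
  product-Haar measure, the weight is continuous on it (and everywhere for `β > 0`);
* `0 < Z` for every real `β` and `δ > 0` (`admissiblePartitionFunction_pos`: a box around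
  `U ≡ 1` where the weight is bounded below), hence `admissibleMeasure ρ β δ` is a probability
  measure for `β ≥ 0 < δ` (`isProbabilityMeasure_admissibleMeasure`); `Z` and the expectation as
  honest real (Bochner) integrals against product Haar measure
  (`admissiblePartitionFunction_eq_ofReal_integral`, `admissibleExpectation_eq_smul_integral`);
* the elementary comparison with the Hernández–Jansen–Lüscher norm form: for a unitary matrix
  `V`, `‖1 - V‖² ≤ 2 Re tr(1 - V)` in the operator norm (`norm_one_sub_sq_le_of_mem_unitaryGroup`:
  operator norm ≤ Frobenius norm `= (Re tr (1-V)ᴴ(1-V))^{1/2}` and `(1-V)ᴴ(1-V) = 2 - V - Vᴴ`),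
  so for a unitary-valued `ρ` every admissible configuration with cut `δ` satisfies
  `‖1 - ρ(U_p)‖ < √(2δ)` for all `p` (`norm_one_sub_lt_of_mem_admissibleSet`,
  `admissibleSet_subset_normAdmissibleSet`); `√(2/1800) = 1/30` (`sqrt_two_mul_one_div_1800`).

## References

* M. Lüscher, Nucl. Phys. B 549 (1999) 295, §2.1 [Luscher1999AbelianChiral].
* P. Hernández, K. Jansen, M. Lüscher, Nucl. Phys. B 552 (1999) 363, eqs. (2.15)–(2.16), §2.5
  [HernandezJansenLuscher1999].
* H. Fukaya et al. (JLQCD), Phys. Rev. D 74 (2006) 094505, eq. (2.2) [FukayaEtAl2006].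
-/

open MeasureTheory Filter Complex
open Literature.RepresentationTheory.CompactGroups
open scoped Topology ENNReal Matrix

namespace Literature.MathematicalPhysics.QuantumFieldTheory

/-! ## The cut-off factor -/

section Cutoff

variable {β δ t : ℝ}

/-- The cut-off factor is non-zero exactly below the cut. [folklore] -/
theorem admissibleCutoff_ne_zero_iff : admissibleCutoff β δ t ≠ 0 ↔ t < δ := by
  rw [← admissibleCutoff_pos_iff (β := β), lt_iff_le_and_ne]
  exact ⟨fun h => ⟨admissibleCutoff_nonneg β δ t, h.symm⟩, fun h => h.2.symm⟩

/-- A uniform positive lower bound near zero defect: for `|t| ≤ δ/2`,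
`exp(-|β| δ) ≤ w_{β,δ}(t)` (then `1 - t/δ ≥ 1/2` and `|β t| ≤ |β| δ/2`). [folklore] -/
theorem exp_neg_le_admissibleCutoff (hδ : 0 < δ) (ht : |t| ≤ δ / 2) :
    Real.exp (-(|β| * δ)) ≤ admissibleCutoff β δ t := by
  have ht2 : t ≤ δ / 2 := (abs_le.1 ht).2
  have htδ : t < δ := ht2.trans_lt (half_lt_self hδ)
  rw [admissibleCutoff_of_lt htδ, Real.exp_le_exp, neg_le_neg_iff]
  have h1 : 1 / 2 ≤ 1 - t / δ := by
    have : t / δ ≤ 1 / 2 := by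
      rw [div_le_iff₀ hδ]
      linarith
    linarith
  have h2 : 0 < 1 - t / δ := lt_of_lt_of_le one_half_pos h1
  rw [div_le_iff₀ h2]
  calc β * t ≤ |β * t| := le_abs_self _
    _ = |β| * |t| := abs_mul β t
    _ ≤ |β| * (δ / 2) := mul_le_mul_of_nonneg_left ht (abs_nonneg β)
    _ = |β| * δ * (1 / 2) := by ring
    _ ≤ |β| * δ * (1 - t / δ) :=
        mul_le_mul_of_nonneg_left h1 (mul_nonneg (abs_nonneg β) hδ.le)

/-- The cut-off factor is Borel measurable. [folklore] -/
theorem measurable_admissibleCutoff (β δ : ℝ) : Measurable (admissibleCutoff β δ) := by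
  refine Measurable.ite measurableSet_Iio (Real.measurable_exp.comp ?_) measurable_const
  exact ((measurable_const.mul measurable_id).div
    (measurable_const.sub (measurable_id.div measurable_const))).neg

/-- The cut-off factor is continuous below the cut (`δ > 0`). [folklore] -/
theorem continuousOn_admissibleCutoff (β : ℝ) (hδ : 0 < δ) :
    ContinuousOn (admissibleCutoff β δ) (Set.Iio δ) := by
  have hc : ContinuousOn (fun t : ℝ => Real.exp (-(β * t / (1 - t / δ)))) (Set.Iio δ) := by
    refine Real.continuous_exp.comp_continuousOn (ContinuousOn.neg ?_)
    refine ContinuousOn.div (by fun_prop) (by fun_prop) fun t ht => ?_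
    exact (sub_pos.2 ((div_lt_one hδ).2 ht)).ne'
  exact hc.congr fun t ht => admissibleCutoff_of_lt ht

/-- Left limit at the cut: for `β > 0 < δ`, `exp(-β t/(1 - t/δ)) → 0` as `t ↑ δ`
(`1 - t/δ ↓ 0`, so the exponent tends to `-∞`). [folklore] -/
theorem tendsto_admissibleCutoff_nhdsLT (hβ : 0 < β) (hδ : 0 < δ) :
    Tendsto (admissibleCutoff β δ) (𝓝[<] δ) (𝓝 0) := by
  have h1 : Tendsto (fun t : ℝ => 1 - t / δ) (𝓝[<] δ) (𝓝[>] 0) := by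
    refine tendsto_nhdsWithin_of_tendsto_nhds_of_eventually_within _ ?_ ?_
    · have h : Tendsto (fun t : ℝ => 1 - t / δ) (𝓝 δ) (𝓝 (1 - δ / δ)) :=
        tendsto_const_nhds.sub (tendsto_id.div_const δ)
      rw [div_self hδ.ne', sub_self] at h
      exact h.mono_left nhdsWithin_le_nhds
    · filter_upwards [self_mem_nhdsWithin] with t ht
      exact sub_pos.2 ((div_lt_one hδ).2 ht)
  have h2 : Tendsto (fun t : ℝ => (1 - t / δ)⁻¹) (𝓝[<] δ) atTop :=
    tendsto_inv_nhdsGT_zero.comp h1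
  have h3 : Tendsto (fun t : ℝ => β * t * (1 - t / δ)⁻¹) (𝓝[<] δ) atTop := by
    refine Tendsto.pos_mul_atTop (mul_pos hβ hδ) ?_ h2
    exact (tendsto_const_nhds.mul tendsto_id).mono_left nhdsWithin_le_nhds
  have h4 : Tendsto (fun t : ℝ => Real.exp (-(β * t / (1 - t / δ)))) (𝓝[<] δ) (𝓝 0) := by
    have h := Real.tendsto_exp_atBot.comp (tendsto_neg_atTop_atBot.comp h3)
    simpa only [Function.comp_def, div_eq_mul_inv] using h
  refine h4.congr' ?_
  filter_upwards [self_mem_nhdsWithin] with t ht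
  exact (admissibleCutoff_of_lt ht).symm

/-- For `β > 0 < δ` the cut-off factor is continuous on all of `ℝ` (Lüscher 1999 §2.1: the
Boltzmann factor is a smooth function of the link variables; only continuity is proved). [folklore] -/
theorem continuous_admissibleCutoff (hβ : 0 < β) (hδ : 0 < δ) :
    Continuous (admissibleCutoff β δ) := by
  rw [continuous_iff_continuousAt]
  intro a
  rcases lt_trichotomy a δ with ha | rfl | ha
  · exact (continuousOn_admissibleCutoff β hδ).continuousAt (Iio_mem_nhds ha)
  · have h0 : admissibleCutoff β a a = 0 := admissibleCutoff_of_le le_rfl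
    rw [continuousAt_iff_continuous_left'_right']
    constructor
    · rw [ContinuousWithinAt, h0]
      exact tendsto_admissibleCutoff_nhdsLT hβ hδ
    · rw [ContinuousWithinAt, h0]
      refine (tendsto_const_nhds (x := (0 : ℝ))).congr' ?_
      filter_upwards [self_mem_nhdsWithin] with t ht
      exact (admissibleCutoff_of_le (le_of_lt ht)).symm
  · have h : (fun _ : ℝ => (0 : ℝ)) =ᶠ[𝓝 a] admissibleCutoff β δ := by
      filter_upwards [Ioi_mem_nhds ha] with t ht
      exact (admissibleCutoff_of_le (le_of_lt ht)).symm
    exact continuousAt_const.congr h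

/-- **Wilson limit**: as the cut is removed, `δ → ∞`, the cut-off factor tends to the Wilson
factor `exp(-β t)` (JLQCD 2006, after eq. (2.2): for `1/ε = 0` the action "reduces to the
standard Wilson gauge action"). [folklore] -/
theorem tendsto_admissibleCutoff_atTop (β t : ℝ) :
    Tendsto (fun δ : ℝ => admissibleCutoff β δ t) atTop (𝓝 (Real.exp (-(β * t)))) := by
  have h1 : Tendsto (fun δ : ℝ => 1 - t / δ) atTop (𝓝 1) := by
    have h := (tendsto_const_nhds (x := t)).div_atTop tendsto_id
    simpa using (tendsto_const_nhds (x := (1 : ℝ))).sub h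
  have h2 : Tendsto (fun δ : ℝ => Real.exp (-(β * t / (1 - t / δ)))) atTop
      (𝓝 (Real.exp (-(β * t)))) := by
    have h : Tendsto (fun δ : ℝ => β * t / (1 - t / δ)) atTop (𝓝 (β * t / 1)) :=
      tendsto_const_nhds.div h1 one_ne_zero
    rw [div_one] at h
    exact (Real.continuous_exp.tendsto _).comp h.neg
  refine h2.congr' ?_
  filter_upwards [eventually_gt_atTop t] with δ hδ
  exact (admissibleCutoff_of_lt hδ).symm

end Cutoff

/-! ## The defect -/

section Defect

variable {N : ℕ} {G : Type*} [Group G] (ρ : G →* Matrix (Fin N) (Fin N) ℂ) [TopologicalSpace G]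

/-- The defect is continuous for a continuous representation. [folklore] -/
theorem continuous_traceDefect (hρ : Continuous ρ) : Continuous (traceDefect ρ) :=
  continuous_const.sub (Complex.continuous_re.comp hρ.matrix_trace)

variable [IsTopologicalGroup G] [CompactSpace G]

/-- `t(g) ≤ 2N` for a continuous representation of a compact group. [folklore] -/
theorem traceDefect_le (hρ : Continuous ρ) (g : G) : traceDefect ρ g ≤ 2 * N := by
  have h := (abs_le.1 (CompactGroup.abs_re_trace_le_card ρ hρ g)).1
  simp only [Fintype.card_fin] at h
  unfold traceDefect
  linarith

/-- `t(g⁻¹) = t(g)` for a continuous representation of a compact group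
(`Re tr ρ(g⁻¹) = Re tr ρ(g)`). [folklore] -/
theorem traceDefect_inv (hρ : Continuous ρ) (g : G) : traceDefect ρ g⁻¹ = traceDefect ρ g := by
  rw [traceDefect, traceDefect, CompactGroup.re_trace_map_inv ρ hρ]

end Defect

section Plaquette

variable {d L N : ℕ} {G : Type*} [Group G] (ρ : G →* Matrix (Fin N) (Fin N) ℂ)
  [TopologicalSpace G] [IsTopologicalGroup G]

/-- The plaquette defect is a continuous function of the configuration (product topology) for a
continuous representation. [folklore] -/
theorem continuous_plaquetteDefect (hρ : Continuous ρ) (p : Plaquette d L) :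
    Continuous fun U : GaugeConfig d L G => plaquetteDefect ρ U p := by
  have h : Continuous fun U : GaugeConfig d L G => plaquetteHolonomy U p.1 p.2.1.1 p.2.1.2 := by
    unfold plaquetteHolonomy
    fun_prop
  exact (continuous_traceDefect ρ hρ).comp h

/-- `tₚ(U) ≤ 2N` (continuous `ρ`, compact `G`). [folklore] -/
theorem plaquetteDefect_le [CompactSpace G] (hρ : Continuous ρ) (U : GaugeConfig d L G)
    (p : Plaquette d L) : plaquetteDefect ρ U p ≤ 2 * N :=
  traceDefect_le ρ hρ _

variable [MeasurableSpace G] [BorelSpace G]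

/-- The plaquette defect is measurable for the PRODUCT σ-algebra on `Edge → G`, for every
topological group `G` with its Borel σ-algebra and continuous `ρ` (no second countability:
`ρ(U_p)` is a product of the matrices `ρ(U_e)^{±1}`, whose entries are measurable functions of
one coordinate each). [folklore] -/
theorem measurable_plaquetteDefect (hρ : Continuous ρ) (p : Plaquette d L) :
    Measurable fun U : GaugeConfig d L G => plaquetteDefect ρ U p := by
  have h1 : ∀ (e : Edge d L) (k l : Fin N), Measurable fun U : GaugeConfig d L G => ρ (U e) k l :=
    fun e k l => (hρ.matrix_elem k l).measurable.comp (measurable_pi_apply e)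
  have h2 : ∀ (e : Edge d L) (k l : Fin N),
      Measurable fun U : GaugeConfig d L G => ρ (U e)⁻¹ k l :=
    fun e k l => ((hρ.comp continuous_inv).matrix_elem k l).measurable.comp (measurable_pi_apply e)
  have hmul : ∀ {f g : GaugeConfig d L G → Matrix (Fin N) (Fin N) ℂ},
      (∀ k l, Measurable fun U => f U k l) → (∀ k l, Measurable fun U => g U k l) →
        ∀ k l, Measurable fun U => (f U * g U) k l := by
    intro f g hf hg k l
    simp only [Matrix.mul_apply]
    exact Finset.measurable_sum _ fun c _ => (hf k c).mul (hg c l)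
  have hP : ∀ k l, Measurable fun U : GaugeConfig d L G =>
      ρ (plaquetteHolonomy U p.1 p.2.1.1 p.2.1.2) k l := by
    intro k l
    simp only [plaquetteHolonomy, map_mul]
    exact hmul (hmul (hmul (h1 _) (h1 _)) (h2 _)) (h2 _) k l
  simp only [plaquetteDefect, traceDefect, Matrix.trace, Matrix.diag_apply, Complex.re_sum]
  exact measurable_const.sub (Finset.measurable_sum _ fun k _ => Complex.measurable_re.comp (hP k k))

end Plaquette

/-! ## The admissible set -/

section Admissible

variable {d L N : ℕ} [NeZero L] {G : Type*} [Group G] (ρ : G →* Matrix (Fin N) (Fin N) ℂ)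
  [TopologicalSpace G] [IsTopologicalGroup G]

/-- The admissible set is open (continuous `ρ`; finitely many plaquettes). [folklore] -/
theorem isOpen_admissibleSet (hρ : Continuous ρ) (δ : ℝ) :
    IsOpen (admissibleSet (d := d) (L := L) ρ δ) := by
  have h : admissibleSet (d := d) (L := L) ρ δ =
      ⋂ p : Plaquette d L, (fun U : GaugeConfig d L G => plaquetteDefect ρ U p) ⁻¹' Set.Iio δ := by
    ext U
    simp [mem_admissibleSet_iff]
  rw [h]
  exact isOpen_iInter_of_finite fun p => isOpen_Iio.preimage (continuous_plaquetteDefect ρ hρ p)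

variable [MeasurableSpace G] [BorelSpace G]

/-- The admissible set is measurable for the product σ-algebra (continuous `ρ`). [folklore] -/
theorem measurableSet_admissibleSet (hρ : Continuous ρ) (δ : ℝ) :
    MeasurableSet (admissibleSet (d := d) (L := L) ρ δ) := by
  have h : admissibleSet (d := d) (L := L) ρ δ =
      ⋂ p : Plaquette d L, (fun U : GaugeConfig d L G => plaquetteDefect ρ U p) ⁻¹' Set.Iio δ := by
    ext U
    simp [mem_admissibleSet_iff]
  rw [h]
  exact MeasurableSet.iInter fun p => measurableSet_Iio.preimage (measurable_plaquetteDefect ρ hρ p)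

/-- The admissible set has positive product-Haar measure for `δ > 0`: it is open and contains
`U ≡ 1`, and Haar measure charges non-empty open sets. [folklore] -/
theorem measure_admissibleSet_pos [CompactSpace G] (hρ : Continuous ρ) {δ : ℝ} (hδ : 0 < δ) :
    0 < Measure.pi (fun _ : Edge d L => haarProbability G) (admissibleSet ρ δ) := by
  haveI : (haarProbability G).IsOpenPosMeasure := by
    rw [haarProbability]
    infer_instance
  exact (isOpen_admissibleSet ρ hρ δ).measure_pos _ ⟨1, one_mem_admissibleSet ρ hδ⟩

end Admissible

/-! ## Operator norm versus trace: the Hernández–Jansen–Lüscher norm form -/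

section NormComparison

open scoped Matrix.Norms.L2Operator

variable {N : ℕ}

/-- The operator norm of a square complex matrix is at most its Frobenius norm:
`‖A‖² ≤ ∑ᵢⱼ |Aᵢⱼ|²` (row-wise Cauchy–Schwarz). [folklore] -/
theorem l2_opNorm_sq_le_sum_norm_sq (A : Matrix (Fin N) (Fin N) ℂ) :
    ‖A‖ ^ 2 ≤ ∑ i, ∑ j, ‖A i j‖ ^ 2 := by
  set S : ℝ := ∑ i, ∑ j, ‖A i j‖ ^ 2 with hS
  have hS0 : 0 ≤ S := Finset.sum_nonneg fun i _ => Finset.sum_nonneg fun j _ => sq_nonneg _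
  have hb : ‖A‖ ≤ Real.sqrt S := by
    rw [Matrix.cstar_norm_def]
    refine ContinuousLinearMap.opNorm_le_bound _ (Real.sqrt_nonneg S) fun x => ?_
    rw [← Real.sqrt_sq (norm_nonneg (Matrix.toEuclideanCLM (n := Fin N) (𝕜 := ℂ) A x)),
      ← Real.sqrt_sq (norm_nonneg x), ← Real.sqrt_mul hS0]
    refine Real.sqrt_le_sqrt ?_
    rw [EuclideanSpace.norm_sq_eq, EuclideanSpace.norm_sq_eq, hS, Finset.sum_mul]
    refine Finset.sum_le_sum fun i _ => ?_
    have hi : (Matrix.toEuclideanCLM (n := Fin N) (𝕜 := ℂ) A x) i = ∑ j, A i j * x j := by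
      rw [Matrix.ofLp_toEuclideanCLM]
      rfl
    rw [hi]
    have hsum : ‖∑ j, A i j * x j‖ ≤ ∑ j, ‖A i j‖ * ‖x j‖ :=
      (norm_sum_le _ _).trans_eq (Finset.sum_congr rfl fun j _ => norm_mul _ _)
    calc ‖∑ j, A i j * x j‖ ^ 2 ≤ (∑ j, ‖A i j‖ * ‖x j‖) ^ 2 := by
          gcongr
      _ ≤ (∑ j, ‖A i j‖ ^ 2) * ∑ j, ‖x j‖ ^ 2 := Finset.sum_mul_sq_le_sq_mul_sq _ _ _
  calc ‖A‖ ^ 2 ≤ Real.sqrt S ^ 2 := by gcongr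
    _ = S := Real.sq_sqrt hS0

/-- `∑ᵢⱼ |Aᵢⱼ|² = Re tr(Aᴴ A)` for a complex matrix. [folklore] -/
theorem sum_norm_sq_eq_re_trace_conjTranspose_mul_self (A : Matrix (Fin N) (Fin N) ℂ) :
    ∑ i, ∑ j, ‖A i j‖ ^ 2 = (Aᴴ * A).trace.re := by
  simp only [Matrix.trace, Matrix.diag_apply, Matrix.mul_apply, Matrix.conjTranspose_apply,
    Complex.re_sum, Complex.star_def]
  rw [Finset.sum_comm]
  refine Finset.sum_congr rfl fun j _ => Finset.sum_congr rfl fun i _ => ?_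
  rw [Complex.conj_mul', ← Complex.ofReal_pow, Complex.ofReal_re]

/-- For a unitary matrix `V`: `∑ᵢⱼ |(1 - V)ᵢⱼ|² = 2 (N - Re tr V) = 2 Re tr(1 - V)`
(`(1 - V)ᴴ(1 - V) = 2 - V - Vᴴ` since `VᴴV = 1`). [folklore] -/
theorem sum_norm_sq_one_sub_eq_of_mem_unitaryGroup {V : Matrix (Fin N) (Fin N) ℂ}
    (hV : V ∈ Matrix.unitaryGroup (Fin N) ℂ) :
    ∑ i, ∑ j, ‖((1 : Matrix (Fin N) (Fin N) ℂ) - V) i j‖ ^ 2 = 2 * ((N : ℝ) - V.trace.re) := by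
  rw [sum_norm_sq_eq_re_trace_conjTranspose_mul_self]
  have hVV : Vᴴ * V = 1 := by
    have h := Matrix.mem_unitaryGroup_iff'.1 hV
    rwa [Matrix.star_eq_conjTranspose] at h
  have h : ((1 : Matrix (Fin N) (Fin N) ℂ) - V)ᴴ * (1 - V) = 1 - V - (Vᴴ - 1) := by
    rw [Matrix.conjTranspose_sub, Matrix.conjTranspose_one, sub_mul, one_mul, mul_sub, mul_one,
      hVV]
  rw [h, Matrix.trace_sub, Matrix.trace_sub, Matrix.trace_sub, Matrix.trace_one,
    Matrix.trace_conjTranspose, Fintype.card_fin]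
  simp only [Complex.sub_re, Complex.natCast_re, Complex.star_def, Complex.conj_re]
  ring

/-- **Operator norm versus trace for unitary matrices**: `‖1 - V‖² ≤ 2 (N - Re tr V)
= 2 Re tr(1 - V)` (operator norm on `ℂ^N`; equality of the Frobenius norm, which dominates
the operator norm). This is the comparison between the trace form `Re tr(1 - U_p) < δ` and the
Hernández–Jansen–Lüscher norm form `‖1 - U_p‖ ≤ ε` of admissibility. [folklore] -/
theorem norm_one_sub_sq_le_of_mem_unitaryGroup {V : Matrix (Fin N) (Fin N) ℂ}
    (hV : V ∈ Matrix.unitaryGroup (Fin N) ℂ) :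
    ‖(1 : Matrix (Fin N) (Fin N) ℂ) - V‖ ^ 2 ≤ 2 * ((N : ℝ) - V.trace.re) :=
  (l2_opNorm_sq_le_sum_norm_sq _).trans_eq (sum_norm_sq_one_sub_eq_of_mem_unitaryGroup hV)

variable {G : Type*} [Group G] (ρ : G →* Matrix (Fin N) (Fin N) ℂ)

/-- For a unitary-valued representation, `‖1 - ρ(g)‖² ≤ 2 t(g)`. [folklore] -/
theorem norm_one_sub_sq_le_two_mul_traceDefect
    (hρu : ∀ g, ρ g ∈ Matrix.unitaryGroup (Fin N) ℂ) (g : G) :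
    ‖(1 : Matrix (Fin N) (Fin N) ℂ) - ρ g‖ ^ 2 ≤ 2 * traceDefect ρ g :=
  norm_one_sub_sq_le_of_mem_unitaryGroup (hρu g)

variable {d L : ℕ}

/-- **Trace admissibility implies norm admissibility**: for a unitary-valued `ρ` and an
admissible configuration with cut `δ` (`tₚ(U) < δ` for all `p`), every plaquette satisfies
`‖1 - ρ(U_p)‖ < √(2δ)` — with `δ = 1/1800`, `√(2δ) = 1/30`, the constant of Hernández–Jansen–Lüscher
(1999) §2.5. [folklore] -/
theorem norm_one_sub_lt_of_mem_admissibleSet (hρu : ∀ g, ρ g ∈ Matrix.unitaryGroup (Fin N) ℂ)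
    {δ : ℝ} {U : GaugeConfig d L G} (hU : U ∈ admissibleSet ρ δ) (p : Plaquette d L) :
    ‖(1 : Matrix (Fin N) (Fin N) ℂ) - ρ (plaquetteHolonomy U p.1 p.2.1.1 p.2.1.2)‖ <
      Real.sqrt (2 * δ) := by
  refine (Real.lt_sqrt (norm_nonneg _)).2 ?_
  calc ‖(1 : Matrix (Fin N) (Fin N) ℂ) - ρ (plaquetteHolonomy U p.1 p.2.1.1 p.2.1.2)‖ ^ 2
      ≤ 2 * plaquetteDefect ρ U p := norm_one_sub_sq_le_two_mul_traceDefect ρ hρu _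
    _ < 2 * δ := by linarith [hU p]

/-- `admissibleSet ρ δ ⊆ normAdmissibleSet ρ √(2δ)` for a unitary-valued `ρ`. [folklore] -/
theorem admissibleSet_subset_normAdmissibleSet
    (hρu : ∀ g, ρ g ∈ Matrix.unitaryGroup (Fin N) ℂ) (δ : ℝ) :
    admissibleSet (d := d) (L := L) ρ δ ⊆ normAdmissibleSet ρ (Real.sqrt (2 * δ)) :=
  fun _ hU p => norm_one_sub_lt_of_mem_admissibleSet ρ hρu hU p

/-- The numerics of the route's cut: `√(2 · 1/1800) = 1/30`. [folklore] -/
theorem sqrt_two_mul_one_div_1800 : Real.sqrt (2 * (1 / 1800)) = 1 / 30 := by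
  rw [show (2 : ℝ) * (1 / 1800) = (1 / 30) ^ 2 by norm_num]
  exact Real.sqrt_sq (by norm_num)

end NormComparison

/-! ## The weight -/

section Weight

variable {d L N : ℕ} [NeZero L] {G : Type*} [Group G] (ρ : G →* Matrix (Fin N) (Fin N) ℂ)
variable {β δ : ℝ}

/-- The support of the weight is the admissible set. [folklore] -/
theorem support_admissiblePlaquetteWeight (β δ : ℝ) :
    Function.support (admissiblePlaquetteWeight (d := d) (L := L) ρ β δ) = admissibleSet ρ δ := by
  ext U
  rw [Function.mem_support]
  refine ⟨fun h => ?_, fun h => (admissiblePlaquetteWeight_pos_iff ρ |>.2 h).ne'⟩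
  by_contra hU
  exact h (admissiblePlaquetteWeight_eq_zero_of_not_mem ρ hU)

/-- The weight is the indicator of the admissible set times `exp(-β S_δ)`. [folklore] -/
theorem admissiblePlaquetteWeight_eq_indicator (β δ : ℝ) :
    admissiblePlaquetteWeight (d := d) (L := L) ρ β δ =
      (admissibleSet ρ δ).indicator fun U => Real.exp (-(β * admissibleAction ρ δ U)) := by
  funext U
  by_cases hU : U ∈ admissibleSet ρ δ
  · rw [Set.indicator_of_mem hU, admissiblePlaquetteWeight_eq_exp_of_mem ρ hU]
  · rw [Set.indicator_of_notMem hU, admissiblePlaquetteWeight_eq_zero_of_not_mem ρ hU]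

/-- A uniform lower bound near the trivial configuration: if every `|tₚ(U)| ≤ δ/2` then
`exp(-|β| δ) ^ #plaquettes ≤ w(U)`. [folklore] -/
theorem pow_le_admissiblePlaquetteWeight (hδ : 0 < δ) {U : GaugeConfig d L G}
    (hU : ∀ p : Plaquette d L, |plaquetteDefect ρ U p| ≤ δ / 2) :
    Real.exp (-(|β| * δ)) ^ Fintype.card (Plaquette d L) ≤ admissiblePlaquetteWeight ρ β δ U := by
  rw [← Finset.card_univ, ← Finset.prod_const]
  exact Finset.prod_le_prod (fun _ _ => (Real.exp_pos _).le)
    fun p _ => exp_neg_le_admissibleCutoff hδ (hU p)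

/-- **Wilson limit of the weight**: `w_{β,δ}(U) → exp(-β S(U))` as `δ → ∞`, with `S` the Wilson
action of Wave 0 (the density of `wilsonWeight ρ β`). [folklore] -/
theorem tendsto_admissiblePlaquetteWeight_atTop (β : ℝ) (U : GaugeConfig d L G) :
    Tendsto (fun δ : ℝ => admissiblePlaquetteWeight ρ β δ U) atTop
      (𝓝 (Real.exp (-(β * wilsonAction ρ U)))) := by
  have h : Real.exp (-(β * wilsonAction ρ U)) =
      ∏ p : Plaquette d L, Real.exp (-(β * plaquetteDefect ρ U p)) := by
    rw [wilsonAction_eq_sum_plaquetteDefect, Finset.mul_sum, ← Finset.sum_neg_distrib, Real.exp_sum]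
  rw [h]
  unfold admissiblePlaquetteWeight
  exact tendsto_finsetProd _ fun p _ => tendsto_admissibleCutoff_atTop β _

variable [TopologicalSpace G] [IsTopologicalGroup G]

/-- The weight is continuous on the (open) admissible set (continuous `ρ`, `δ > 0`). [folklore] -/
theorem continuousOn_admissiblePlaquetteWeight (hρ : Continuous ρ) (β : ℝ) (hδ : 0 < δ) :
    ContinuousOn (admissiblePlaquetteWeight (d := d) (L := L) ρ β δ) (admissibleSet ρ δ) := by
  refine continuousOn_finsetProd _ fun p _ => ?_
  exact (continuousOn_admissibleCutoff β hδ).comp (continuous_plaquetteDefect ρ hρ p).continuousOn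
    fun U hU => hU p

/-- For `β > 0 < δ` the weight is continuous everywhere (continuous `ρ`). [folklore] -/
theorem continuous_admissiblePlaquetteWeight (hρ : Continuous ρ) (hβ : 0 < β) (hδ : 0 < δ) :
    Continuous (admissiblePlaquetteWeight (d := d) (L := L) ρ β δ) :=
  continuous_finsetProd _ fun p _ =>
    (continuous_admissibleCutoff hβ hδ).comp (continuous_plaquetteDefect ρ hρ p)

variable [MeasurableSpace G] [BorelSpace G]

/-- The weight is measurable for the product σ-algebra (continuous `ρ`; no countability
assumption on `G`). [folklore] -/
theorem measurable_admissiblePlaquetteWeight (hρ : Continuous ρ) (β δ : ℝ) :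
    Measurable (admissiblePlaquetteWeight (d := d) (L := L) ρ β δ) := by
  refine Finset.measurable_prod _ fun p _ => ?_
  exact (measurable_admissibleCutoff β δ).comp (measurable_plaquetteDefect ρ hρ p)

/-- For `β ≥ 0` the weight is integrable against product Haar measure (bounded by `1`,
measurable; continuous `ρ`, compact `G`). [folklore] -/
theorem integrable_admissiblePlaquetteWeight [CompactSpace G] (hρ : Continuous ρ) (hβ : 0 ≤ β)
    (δ : ℝ) :
    Integrable (admissiblePlaquetteWeight (d := d) (L := L) ρ β δ)
      (Measure.pi fun _ : Edge d L => haarProbability G) := by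
  refine (integrable_const (1 : ℝ)).mono'
    (measurable_admissiblePlaquetteWeight ρ hρ β δ).aestronglyMeasurable
    (Eventually.of_forall fun U => ?_)
  rw [Real.norm_eq_abs, abs_of_nonneg (admissiblePlaquetteWeight_nonneg ρ β δ U)]
  exact admissiblePlaquetteWeight_le_one ρ hρ hβ δ U

end Weight

/-! ## The partition function and the normalised measure -/

section Measure

variable {d L N : ℕ} [NeZero L] {G : Type*} [Group G] [TopologicalSpace G] [IsTopologicalGroup G]
  [CompactSpace G] [MeasurableSpace G] [BorelSpace G] (ρ : G →* Matrix (Fin N) (Fin N) ℂ)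
variable {β δ : ℝ}

/-- `0 < Z` for every real `β` and `δ > 0`: on the open set `{U | ∀ p, |tₚ(U)| < δ/2} ∋ 1`, of
positive product-Haar measure, the weight is at least `exp(-|β|δ) ^ #plaquettes`. [folklore] -/
theorem admissiblePartitionFunction_pos (hρ : Continuous ρ) (β : ℝ) (hδ : 0 < δ) :
    0 < admissiblePartitionFunction (d := d) (L := L) ρ β δ := by
  haveI : (haarProbability G).IsOpenPosMeasure := by
    rw [haarProbability]
    infer_instance
  set μ : Measure (GaugeConfig d L G) := Measure.pi fun _ : Edge d L => haarProbability G
  set c : ℝ := Real.exp (-(|β| * δ)) ^ Fintype.card (Plaquette d L) with hc_def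
  have hc : 0 < c := pow_pos (Real.exp_pos _) _
  set O : Set (GaugeConfig d L G) := {U | ∀ p : Plaquette d L, |plaquetteDefect ρ U p| < δ / 2}
    with hO_def
  have hO_eq : O = ⋂ p : Plaquette d L,
      (fun U : GaugeConfig d L G => |plaquetteDefect ρ U p|) ⁻¹' Set.Iio (δ / 2) := by
    ext U
    simp [hO_def]
  have hO : IsOpen O := by
    rw [hO_eq]
    exact isOpen_iInter_of_finite fun p =>
      isOpen_Iio.preimage (continuous_plaquetteDefect ρ hρ p).abs
  have hOm : MeasurableSet O := by
    rw [hO_eq]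
    exact MeasurableSet.iInter fun p =>
      measurableSet_Iio.preimage (measurable_plaquetteDefect ρ hρ p).abs
  have h1 : (1 : GaugeConfig d L G) ∈ O := fun p => by
    simpa using half_pos hδ
  have hle : O.indicator (fun _ => ENNReal.ofReal c) ≤
      fun U => ENNReal.ofReal (admissiblePlaquetteWeight ρ β δ U) := by
    intro U
    by_cases hU : U ∈ O
    · rw [Set.indicator_of_mem hU]
      exact ENNReal.ofReal_le_ofReal (pow_le_admissiblePlaquetteWeight ρ hδ fun p => (hU p).le)
    · rw [Set.indicator_of_notMem hU]
      exact bot_le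
  rw [admissiblePartitionFunction_eq_lintegral]
  calc (0 : ℝ≥0∞) < ENNReal.ofReal c * μ O :=
        ENNReal.mul_pos (ENNReal.ofReal_pos.2 hc).ne' (hO.measure_pos μ ⟨1, h1⟩).ne'
    _ = ∫⁻ U, O.indicator (fun _ => ENNReal.ofReal c) U ∂μ := (lintegral_indicator_const hOm _).symm
    _ ≤ ∫⁻ U, ENNReal.ofReal (admissiblePlaquetteWeight ρ β δ U) ∂μ := lintegral_mono hle

/-- `Z ≠ 0` (every real `β`, `δ > 0`). [folklore] -/
theorem admissiblePartitionFunction_ne_zero (hρ : Continuous ρ) (β : ℝ) (hδ : 0 < δ) :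
    admissiblePartitionFunction (d := d) (L := L) ρ β δ ≠ 0 :=
  (admissiblePartitionFunction_pos ρ hρ β hδ).ne'

/-- **The admissibility-constrained measure is a probability measure** for continuous `ρ`,
`β ≥ 0` and `δ > 0` (`0 < Z ≤ 1`). [folklore] -/
theorem isProbabilityMeasure_admissibleMeasure (hρ : Continuous ρ) (hβ : 0 ≤ β) (hδ : 0 < δ) :
    IsProbabilityMeasure (admissibleMeasure (d := d) (L := L) ρ β δ) := by
  constructor
  simp only [admissibleMeasure, Measure.smul_apply, smul_eq_mul]
  exact ENNReal.inv_mul_cancel (admissiblePartitionFunction_ne_zero ρ hρ β hδ)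
    (admissiblePartitionFunction_ne_top ρ hρ hβ δ)

/-- `Z` as an honest real integral for `β ≥ 0`: `Z = ENNReal.ofReal (∫ w(U) ∏ₑ dU_e)`. [folklore] -/
theorem admissiblePartitionFunction_eq_ofReal_integral (hρ : Continuous ρ) (hβ : 0 ≤ β) (δ : ℝ) :
    admissiblePartitionFunction (d := d) (L := L) ρ β δ =
      ENNReal.ofReal (∫ U, admissiblePlaquetteWeight ρ β δ U
        ∂(Measure.pi fun _ : Edge d L => haarProbability G)) := by
  rw [admissiblePartitionFunction_eq_lintegral,
    ofReal_integral_eq_lintegral_ofReal (integrable_admissiblePlaquetteWeight ρ hρ hβ δ)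
      (Eventually.of_forall fun U => admissiblePlaquetteWeight_nonneg ρ β δ U)]

/-- `0 < ∫ w(U) ∏ₑ dU_e` (`β ≥ 0`, `δ > 0`). [folklore] -/
theorem integral_admissiblePlaquetteWeight_pos (hρ : Continuous ρ) (hβ : 0 ≤ β) (hδ : 0 < δ) :
    0 < ∫ U, admissiblePlaquetteWeight ρ β δ U
      ∂(Measure.pi fun _ : Edge d L => haarProbability G) := by
  have h := admissiblePartitionFunction_pos (d := d) (L := L) ρ hρ β hδ
  rw [admissiblePartitionFunction_eq_ofReal_integral ρ hρ hβ] at h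
  exact ENNReal.ofReal_pos.1 h

/-- **The expectation as a ratio of product-Haar integrals** (`β ≥ 0`):
`⟨F⟩ = (∫ w)⁻¹ • ∫ w(U) • F(U) ∏ₑ dU_e` — the form in which route OverlapPositivityTransfer
writes its admissible-overlap expectations (both sides are `0` in the junk case `Z = 0`). [folklore] -/
theorem admissibleExpectation_eq_smul_integral {V : Type*} [NormedAddCommGroup V]
    [NormedSpace ℝ V] (hρ : Continuous ρ) (hβ : 0 ≤ β) (δ : ℝ) (F : GaugeConfig d L G → V) :
    admissibleExpectation ρ β δ F =
      (∫ U, admissiblePlaquetteWeight ρ β δ U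
          ∂(Measure.pi fun _ : Edge d L => haarProbability G))⁻¹ •
        ∫ U, admissiblePlaquetteWeight ρ β δ U • F U
          ∂(Measure.pi fun _ : Edge d L => haarProbability G) := by
  set μ : Measure (GaugeConfig d L G) := Measure.pi fun _ : Edge d L => haarProbability G with hμ
  have hw : Measurable fun U : GaugeConfig d L G => (admissiblePlaquetteWeight ρ β δ U).toNNReal :=
    (measurable_admissiblePlaquetteWeight ρ hρ β δ).real_toNNReal
  have h1 : ∫ U, F U ∂(admissibleWeight ρ β δ) =
      ∫ U, admissiblePlaquetteWeight ρ β δ U • F U ∂μ := by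
    have h := integral_withDensity_eq_integral_smul (μ := μ) hw F
    rw [show (μ.withDensity fun U => ((admissiblePlaquetteWeight ρ β δ U).toNNReal : ℝ≥0∞)) =
        admissibleWeight ρ β δ from rfl] at h
    rw [h]
    refine integral_congr_ae (Eventually.of_forall fun U => ?_)
    simp only [NNReal.smul_def, Real.coe_toNNReal _ (admissiblePlaquetteWeight_nonneg ρ β δ U)]
  have hZ : (admissiblePartitionFunction (d := d) (L := L) ρ β δ).toReal =
      ∫ U, admissiblePlaquetteWeight ρ β δ U ∂μ := by
    rw [admissiblePartitionFunction_eq_ofReal_integral ρ hρ hβ,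
      ENNReal.toReal_ofReal (integral_nonneg fun U => admissiblePlaquetteWeight_nonneg ρ β δ U)]
  rw [admissibleExpectation, admissibleMeasure, integral_smul_measure, h1, ENNReal.toReal_inv, hZ]

end Measure

end Literature.MathematicalPhysics.QuantumFieldTheory
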